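import Literature.AlgebraicGeometry.Shioda1982.ExceptionalQuadruplesSweepTwoHundredFortyPartOne
import HarnessLib

/-!
# Shioda 1982 / Meyer–Neutsch 1981: no exceptional quadruple at the level `N = 240` — kernel sweep, part 2 of 2 and assembly

Topic `Literature/AlgebraicGeometry/Shioda1982`; companion of `ExceptionalQuadruplesComplete.lean` (search `checkB`, soundness
`tabelleOneCompleteAt_of_chunks`, invariant form `exists_mem_reps_of_isExceptionalQuadruple`, statement `TabelleOneCompleteAt`; sources,
method and framing in its module docstring) and of the series `ExceptionalQuadruplesSweep*.lean` (together: every level `2 ≤ N ≤ 180`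
that is not a row of Tabelle 1; `…SweepTwoHundredTwenty/…TwoHundredSixty/…ThreeHundredForty.lean`,
`…SweepTwoHundredFiftyTwo/…ThreeHundredNinetySix/…FourHundredSixtyEight.lean`, `…SweepTwoHundred.lean`: the levels `220, 260, 340`, `252, 396, 468`
and `200` of the families `20p`, `36p`, `40p`). THEOREMS only (no definition, no named fact): the same kernel
search at the single level `N = 240`, which carries NO row of [MeyerNeutsch1981Fermatquadrupel, Tabelle 1] (computer-generated there,
"alle Fermatquadrupel für N ≤ 614 ermittelt", §2 p. 53) and lies above the range `N ≤ 180` of Shioda's table p. 727 — by Aoki's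
Theorem C ([Aoki1983], computer-assisted for `181 ≤ m ≤ 672`) there is no exceptional element at any level `> 180`; the files
`ExceptionalQuadruplesSweepTwoHundredFortyPartOne.lean`, `ExceptionalQuadruplesSweepTwoHundredForty.lean` make the instance `N = 240` a kernel statement. The search at
`N = 240` visits 391220 candidate triples (`φ(240) − 1 = 63` units each), too many for one elaboration of bounded wall time, so the
chunks of first entries are spread over 2 files: `ExceptionalQuadruplesSweepTwoHundredFortyPartOne.lean` — first entries `0 ≤ a < 36` (184959 candidates);
`ExceptionalQuadruplesSweepTwoHundredForty.lean` — first entries `36 ≤ a < 240` (206261 candidates); the last one assembles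
`completeAt_twoHundredForty` (every sorted pair-free primitive Hodge 4-multiset mod `240` is standard) and `not_isExceptionalQuadruple_twoHundredForty`.
WHY THIS LEVEL (cell `pub-hfermat`): `240 = 2⁴·3·5`: the tree's character-sum families cover the levels `K·p`, `p` a prime above a bound depending on `K`, for
`K ∈ {2, 3, 4, 6, 8, 9, 10, 12, 18, 20, 24, 36, 40}` or `K` a power of `2` or of `3` (`PicardNumber<K>Prime.lean`, `PicardNumberTwoPowerPrime.lean`,
`PicardNumberThreePowPrime.lean`) and the prime-power levels (`PicardNumberPrimePower.lean`); writing `240 = K·p` with `p` prime forces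
`K ∈ {48, 80, 120}`, none of them among those `K`. `decide +kernel` only (no `native_decide`).

HONEST FRAMING (cell `pub-hfermat`): explicit algebraic cycles for specific Hodge classes on Fermat/Delsarte varieties; residual open
instances listed; no claim on general Hodge. These classes are algebraic (Lefschetz (1,1)); certified here is only the emptiness of the
exceptional list at this level.

## References
* [MeyerNeutsch1981Fermatquadrupel] W. Meyer, W. Neutsch, *Fermatquadrupel*, Math. Ann. 256 (1981) 51–62, §2 p. 53, Tabelle 1 p. 54 (no row 240).
* [Shioda1982PicardFermat] T. Shioda, J. Fac. Sci. Univ. Tokyo IA 28 (1982) 725–734, table p. 727 (levels `≤ 180`), Prop. 4 (Q′) p. 729.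
* [Aoki1983] N. Aoki, Math. Ann. 266 (1983) 23–54, Thm. C.
-/

namespace Literature.AlgebraicGeometry.Shioda1982

open Literature.AlgebraicGeometry.HodgeTheory

set_option maxHeartbeats 0 in
/-- **The search at `N = 240` passes on the first entries `36 ≤ a < 240`** (part 2 of 2: 13 chunks, 206261 candidate
triples): every visited sorted quadruple of representatives there fails the Hodge test or is standard (`checkB`; `reps 240 = []`).
[cite: MeyerNeutsch1981Fermatquadrupel, §2 p. 53 ("alle Fermatquadrupel für N ≤ 614 ermittelt") and Tabelle 1 p. 54 (no row 240)]
[cite: Aoki1983, Thm. C] -/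
theorem checkB_twoHundredForty_partTwo :
    ∀ p ∈ ([(36, 3), (39, 3), (42, 3), (45, 3), (48, 3), (51, 4), (55, 4), (59, 4), (63, 5), (68, 5), (73, 6), (79, 9), (88, 152)] : List (ℕ × ℕ)), checkB 240 p.1 p.2 = true := by
  intro p hp
  simp only [List.mem_cons, List.not_mem_nil, or_false] at hp
  rcases hp with rfl | rfl | rfl | rfl | rfl | rfl | rfl | rfl | rfl | rfl | rfl | rfl | rfl <;> decide +kernel

set_option maxHeartbeats 0 in
/-- **Tabelle 1 is complete at `N = 240`, where it is empty**: every sorted Hodge 4-multiset mod `240` without a pair and with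
`gcd = 1` is standard. Kernel exhaustion (`checkB`, 25 chunks of first entries in 2 files, 391220 candidate triples:
`checkB_twoHundredForty_partOne`, `checkB_twoHundredForty_partTwo`).
[cite: MeyerNeutsch1981Fermatquadrupel, §2 p. 53 ("alle Fermatquadrupel für N ≤ 614 ermittelt") and Tabelle 1 p. 54 (no row 240)]
[cite: Aoki1983, Thm. C] [cite: Shioda1982PicardFermat, Prop. 4 (Q′) p. 729] -/
theorem completeAt_twoHundredForty : TabelleOneCompleteAt 240 :=
  tabelleOneCompleteAt_of_chunks 240 ([(0, 3), (3, 3), (6, 3), (9, 3), (12, 3), (15, 3), (18, 3), (21, 3), (24, 3), (27, 3), (30, 3), (33, 3)] ++ [(36, 3), (39, 3), (42, 3), (45, 3), (48, 3), (51, 4), (55, 4), (59, 4), (63, 5), (68, 5), (73, 6), (79, 9), (88, 152)]) (by decide +kernel) (by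
    intro p hp
    rcases List.mem_append.mp hp with hp | hp
    · exact checkB_twoHundredForty_partOne p hp
    · exact checkB_twoHundredForty_partTwo p hp)

/-- **No exceptional quadruple ("Ausnahmequadrupel") at the level `240`** (`tabelleOne 240 = []`).
[cite: MeyerNeutsch1981Fermatquadrupel, Tabelle 1 p. 54 (no row 240)] [cite: Aoki1983, Thm. C] -/
theorem not_isExceptionalQuadruple_twoHundredForty (s : Multiset (ZMod 240)) : ¬ IsExceptionalQuadruple 240 s := by
  intro hs
  obtain ⟨r, hr, -⟩ := exists_mem_reps_of_isExceptionalQuadruple completeAt_twoHundredForty hs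
  simp [reps, tabelleOne] at hr

end Literature.AlgebraicGeometry.Shioda1982
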